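import Summits.CriticalPhenomena.CardyFormulaZ2.Theorems.CardyIKTransportIKLinearTransportStubPinnedSamplerRowCFTPFinal
import Mathlib.Probability.Kernel.Disintegration.CondCDF
import Mathlib.MeasureTheory.Constructions.Polish.EmbeddingReal

/-!
# Stub `stub_RowCFTP` (A_dyn) — part K: the ROW KERNEL of the exact heat-bath dynamics
# (conditional resampling as a measurable function OF THE STATISTIC VALUE)

Support file (`--supports stmt-CriticalPhenomena-5076`, registered sub-goal `ps3_exists_kernel_resampler`).
The exact row dynamics `Φ y p u z` that `IsRowCFTP` asks for (fields `measurable`, `writes_row`, `cov`,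
`exact`; `…StubPinnedSamplerRowCFTP.lean`) resamples the middle data of row `y` from the conditional law of
the exchanged model `νmix (S ∆ {i,i+1})` given the pinned statistic AND the middle rows below `y`, reading
the ENVIRONMENT PARAMETER `p` (not the statistic of the current configuration, which a sweep has already
modified). So the resampler must be a measurable function of the statistic VALUE: this file proves the
kernel form of the fibrewise resampling lemma (`ps3_transfer_kernel`, adapted from the landed
`ps_transfer_of_uniform`, p94331, whose intermediate map `x u ↦ e⁻¹ (Z (π x, U u))` already factors through
`π x`): on a standard Borel `X`, for a probability `P`, a measurable statistic `π : X → Y` and a uniform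
level `U`, there is a jointly measurable `G : Y × ℝ → X` with
`law_{P ⊗ β} (π x, G (π x, U u)) = law_P (π x, x)` — `G (y, ·)` pushes Lebesgue measure on `(0,1)` to the
conditional law of `P` given `π = y`, for `law(π)`-a.e. `y`. Registered instance
`ps3_exists_kernel_resampler`: `X = Obs`, `Y = (Obs × Set (Site 2 × Site 2)) × Obs` (the value space of
the row statistic `(pinnedStat i, middle rows below y)`), levels read from the fresh bits `β`.

Also here: the ROW VOCABULARY used by the construction of `Φ` (`…StubRowCFTPDynamics.lean`):
`pastMid i y z` (the middle data of the rows `< y`), `rowBits i y x` (the three middle bits of row `y`),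
`setMid i y z B` (overwrite them), with their measurability and locality lemmas.
-/

noncomputable section

namespace Summit.CriticalPhenomena.CardyFormulaZ2.Theorems.IKLinearTransport.PinnedDiagramExchange

open scoped Classical MeasureTheory ENNReal ProbabilityTheory Topology NNReal symmDiff
open Set MeasureTheory ProbabilityTheory Filter
open Literature.Probability.Percolation Literature.Probability.LatticeModels

/-! ## The kernel form of the fibrewise resampling lemma -/

section Transfer

variable {Y : Type*} [MeasurableSpace Y]

/-- KERNEL FORM OF THE TRANSFER LEMMA. On a standard Borel space `X`, for a probability measure `P`, a
measurable statistic `π : X → Y` and an independent uniform level `U` (law `β`), some jointly measurable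
`G : Y × ℝ → X` satisfies `law_{P ⊗ β} (π x, G (π x, U u)) = law_P (π x, x)`: `G (y, t)` is the conditional
quantile of (an embedding into `ℝ` of) `x` given `π x = y` at level `t`, pulled back. [folklore] -/
theorem ps3_transfer_kernel {X R : Type*} [MeasurableSpace X] [StandardBorelSpace X] [Nonempty X]
    [MeasurableSpace R] {π : X → Y} (hπ : Measurable π) (P : Measure X) [IsProbabilityMeasure P]
    {β : Measure R} [IsProbabilityMeasure β] {U : R → ℝ} (hU : Measurable U)
    (hunif : ∀ c ∈ Icc (0 : ℝ) 1, β {u | U u ≤ c} = ENNReal.ofReal c) :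
    ∃ G : Y × ℝ → X, Measurable G ∧
      (P.prod β).map (fun p : X × R => (π p.1, G (π p.1, U p.2))) = P.map (fun x => (π x, x)) := by
  -- adapted from `ps_transfer_of_uniform` (…StubPinnedSamplerTransfer.lean) with `P' = P`
  have hU01 : ∀ᵐ u ∂β, U u ∈ Ioo (0 : ℝ) 1 := ps_ae_mem_Ioo_of_uniform hU hunif
  have he : MeasurableEmbedding (embeddingReal X) := measurableEmbedding_embeddingReal X
  have hπe : Measurable fun x => (π x, embeddingReal X x) := hπ.prodMk he.measurable
  obtain ⟨ρ, hρ⟩ : ∃ ρ : Measure (Y × ℝ), ρ = P.map (fun x => (π x, embeddingReal X x)) := ⟨_, rfl⟩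
  haveI : IsProbabilityMeasure ρ := hρ ▸ Measure.isProbabilityMeasure_map hπe.aemeasurable
  have hfst : ρ.fst = P.map π := by rw [hρ, Measure.fst_map_prodMk he.measurable]
  obtain ⟨Q, hQ⟩ := ps_exists_quantile (condCDF ρ) (tendsto_condCDF_atBot ρ) (tendsto_condCDF_atTop ρ)
  obtain ⟨Z, hZ⟩ : ∃ Z : Y × ℝ → ℝ, Z = fun p => if p.2 ∈ Ioo (0 : ℝ) 1 then Q p.1 p.2 else 0 :=
    ⟨_, rfl⟩
  have hZm : Measurable Z := hZ ▸ ps_measurable_guardedQuantile (measurable_condCDF ρ) hQ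
  have hZle : ∀ y t, t ∈ Ioo (0 : ℝ) 1 → ∀ r, Z (y, t) ≤ r ↔ t ≤ condCDF ρ y r := by
    intro y t ht r
    rw [hZ]
    dsimp only
    rw [if_pos ht]
    exact hQ y t ht r
  obtain ⟨Φ, hΦ⟩ : ∃ Φ : X × R → Y × ℝ, Φ = fun p => (π p.1, Z (π p.1, U p.2)) := ⟨_, rfl⟩
  have hΦm : Measurable Φ :=
    hΦ ▸ (hπ.comp measurable_fst).prodMk (hZm.comp ((hπ.comp measurable_fst).prodMk
      (hU.comp measurable_snd)))
  have key : ∀ {s : Set Y}, MeasurableSet s → ∀ a : ℝ,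
      (P.prod β).map Φ (s ×ˢ Iic a) = ρ (s ×ˢ Iic a) := by
    intro s hs a
    rw [Measure.map_apply hΦm (hs.prod measurableSet_Iic),
      Measure.prod_apply (hΦm (hs.prod measurableSet_Iic))]
    have hsec : ∀ x, β (Prod.mk x ⁻¹' (Φ ⁻¹' (s ×ˢ Iic a))) =
        s.indicator (fun y => ENNReal.ofReal (condCDF ρ y a)) (π x) := by
      intro x
      by_cases hx : π x ∈ s
      · rw [indicator_of_mem hx]
        have hseteq : (Prod.mk x ⁻¹' (Φ ⁻¹' (s ×ˢ Iic a)) : Set R) =ᵐ[β]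
            ({u | U u ≤ condCDF ρ (π x) a} : Set R) := by
          filter_upwards [hU01] with u hu
          refine propext ?_
          change Φ (x, u) ∈ s ×ˢ Iic a ↔ U u ≤ condCDF ρ (π x) a
          rw [hΦ]
          simp only [mem_prod, mem_Iic, hx, true_and]
          exact hZle (π x) (U u) hu a
        rw [measure_congr hseteq, hunif _ ⟨condCDF_nonneg ρ _ _, condCDF_le_one ρ _ _⟩]
      · rw [indicator_of_notMem hx]
        have hempty : (Prod.mk x ⁻¹' (Φ ⁻¹' (s ×ˢ Iic a)) : Set R) = ∅ := by
          ext u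
          simp only [mem_preimage, hΦ, mem_prod, mem_Iic, mem_empty_iff_false, iff_false, not_and]
          exact fun h => absurd h hx
        rw [hempty, measure_empty]
    simp_rw [hsec]
    have hg : Measurable fun y => ENNReal.ofReal (condCDF ρ y a) :=
      (measurable_condCDF ρ a).ennreal_ofReal
    rw [← lintegral_map (hg.indicator hs) hπ, lintegral_indicator hs, ← hfst,
      setLIntegral_condCDF ρ a hs]
  have hlawΦ : (P.prod β).map Φ = ρ := by
    refine Measure.ext_prod fun {s} {t} hs ht => ?_
    have h12 : (((P.prod β).map Φ).restrict (s ×ˢ univ)).snd = (ρ.restrict (s ×ˢ univ)).snd :=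
      Measure.ext_of_Iic _ _ fun a => by
        rw [ps_snd_restrict_prod_univ_apply _ s measurableSet_Iic,
          ps_snd_restrict_prod_univ_apply _ s measurableSet_Iic, key hs a]
    have := congrArg (fun μ : Measure ℝ => μ t) h12
    simpa only [ps_snd_restrict_prod_univ_apply _ s ht] using this
  -- pull back along a measurable left inverse of the embedding
  obtain ⟨einv, heinv, hinv⟩ := he.exists_measurable_extend measurable_id fun _ => ‹Nonempty X›
  have hinv' : ∀ x, einv (embeddingReal X x) = x := fun x => congrFun hinv x
  refine ⟨fun q => einv (Z q), heinv.comp hZm, ?_⟩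
  have hpair : (fun p : X × R => (π p.1, einv (Z (π p.1, U p.2)))) = Prod.map id einv ∘ Φ := by
    funext p; rw [hΦ]; rfl
  have h2 : (fun x => (π x, x)) = Prod.map id einv ∘ (fun x => (π x, embeddingReal X x)) := by
    funext x; simp [hinv']
  rw [hpair, ← Measure.map_map (measurable_id.prodMap heinv) hΦm, hlawΦ, hρ,
    Measure.map_map (measurable_id.prodMap heinv) hπe, h2]

end Transfer

/-- KERNEL RESAMPLER FOR THE OBSERVABLES (registered sub-goal): for any measurable statistic of the
observables with values in `(Obs × Set (Site 2 × Site 2)) × Obs` (in the line: the pinned statistic together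
with the middle rows below a given row), any probability law `P` on `Obs` and a uniform level read from the
fresh bits, a jointly measurable `G` of (statistic value, level) reproduces, jointly with the statistic, the
law of the configuration: `law_{P ⊗ β} (π x, G (π x, U u)) = law_P (π x, x)`. [folklore] -/
theorem ps3_exists_kernel_resampler :
    ∀ (π : Obs → (Obs × Set (Site 2 × Site 2)) × Obs), Measurable π →
      ∀ (P : MeasureTheory.Measure Obs), MeasureTheory.IsProbabilityMeasure P →
      ∀ (U : Rnd → ℝ), Measurable U → (∀ c ∈ Set.Icc (0 : ℝ) 1, β {u | U u ≤ c} = ENNReal.ofReal c) →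
      ∃ G : ((Obs × Set (Site 2 × Site 2)) × Obs) × ℝ → Obs, Measurable G ∧
        (P.prod β).map (fun xu => (π xu.1, G (π xu.1, U xu.2))) = P.map (fun x => (π x, x)) := by
  intro π hπ P hP U hU hunif
  haveI : StandardBorelSpace (Set (Site 2)) := inferInstanceAs (StandardBorelSpace (Site 2 → Prop))
  haveI : IsProbabilityMeasure β := by
    rw [show β = sitePercolation (Site 2 × ℕ) half from rfl]
    infer_instance
  exact ps3_transfer_kernel hπ P hU hunif

/-! ## Row vocabulary: the middle rows below `y`, the three middle bits of row `y`, overwriting them -/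

/-- The middle data (cell column `i+1`, face columns `i, i+1`) of the rows `< y` of `z`. [folklore] -/
def pastMid (i y : ℤ) (z : Obs) : Obs :=
  ({v | v ∈ z.1 ∧ v 0 = i + 1 ∧ v 1 < y}, {f | f ∈ z.2 ∧ (f 0 = i ∨ f 0 = i + 1) ∧ f 1 < y})

/-- The three middle bits of row `y`: colour of the cell `(i+1, y)`, flags of the faces `(i, y)`, `(i+1, y)`.
[folklore] -/
def rowBits (i y : ℤ) (x : Obs) : Prop × Prop × Prop := (![i + 1, y] ∈ x.1, ![i, y] ∈ x.2, ![i + 1, y] ∈ x.2)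

/-- Overwrite the three middle bits of row `y` of `z` by `B`. [folklore] -/
def setMid (i y : ℤ) (z : Obs) (B : Prop × Prop × Prop) : Obs :=
  ({v | (v = ![i + 1, y] ∧ B.1) ∨ (v ≠ ![i + 1, y] ∧ v ∈ z.1)},
   {f | (f = ![i, y] ∧ B.2.1) ∨ (f = ![i + 1, y] ∧ B.2.2) ∨ (f ≠ ![i, y] ∧ f ≠ ![i + 1, y] ∧ f ∈ z.2)})

/-- The two faces of a middle row are distinct. [folklore] -/
theorem ps3_face_ne (i y : ℤ) : (![i, y] : Site 2) ≠ ![i + 1, y] := by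
  intro h
  have := congrFun h 0
  simp at this

/-- `setMid` rewrites only the three middle bits of row `y`. [folklore] -/
theorem setMid_off (i y : ℤ) (z : Obs) (B : Prop × Prop × Prop) :
    (∀ w : Site 2, w ≠ ![i + 1, y] → (w ∈ (setMid i y z B).1 ↔ w ∈ z.1)) ∧
    (∀ f : Site 2, f ≠ ![i, y] → f ≠ ![i + 1, y] → (f ∈ (setMid i y z B).2 ↔ f ∈ z.2)) := by
  refine ⟨fun w hw => ?_, fun f hf1 hf2 => ?_⟩
  · simp only [setMid, mem_setOf_eq]; tauto
  · simp only [setMid, mem_setOf_eq]; tauto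

/-- The middle bits of row `y` after `setMid`. [folklore] -/
theorem rowBits_setMid (i y : ℤ) (z : Obs) (B : Prop × Prop × Prop) :
    (![i + 1, y] ∈ (setMid i y z B).1 ↔ B.1) ∧ (![i, y] ∈ (setMid i y z B).2 ↔ B.2.1) ∧
      (![i + 1, y] ∈ (setMid i y z B).2 ↔ B.2.2) := by
  have hne := ps3_face_ne i y
  refine ⟨?_, ?_, ?_⟩
  · simp [setMid]
  · simp [setMid, hne]
  · simp [setMid, hne.symm]

/-- `setMid` does not read the bits it overwrites: it depends on `z` only off the three middle bits of row
`y`. [folklore] -/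
theorem setMid_congr (i y : ℤ) (z z' : Obs) (B : Prop × Prop × Prop)
    (h1 : ∀ w : Site 2, w ≠ ![i + 1, y] → (w ∈ z.1 ↔ w ∈ z'.1))
    (h2 : ∀ f : Site 2, f ≠ ![i, y] → f ≠ ![i + 1, y] → (f ∈ z.2 ↔ f ∈ z'.2)) :
    setMid i y z B = setMid i y z' B := by
  refine Prod.ext (Set.ext fun w => ?_) (Set.ext fun f => ?_)
  · simp only [setMid, mem_setOf_eq]
    by_cases hw : w = ![i + 1, y]
    · simp [hw]
    · simp [hw, h1 w hw]
  · simp only [setMid, mem_setOf_eq]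
    by_cases hf1 : f = ![i, y]
    · subst hf1; simp [ps3_face_ne i y]
    · by_cases hf2 : f = ![i + 1, y]
      · subst hf2; simp [(ps3_face_ne i y).symm]
      · simp [hf1, hf2, h2 f hf1 hf2]

/-- `pastMid i y` reads only the rows `< y`. [folklore] -/
theorem pastMid_congr (i y : ℤ) (z z' : Obs)
    (h : ∀ w : Site 2, w 1 < y → (w ∈ z.1 ↔ w ∈ z'.1) ∧ (w ∈ z.2 ↔ w ∈ z'.2)) :
    pastMid i y z = pastMid i y z' := by
  refine Prod.ext (Set.ext fun w => ?_) (Set.ext fun f => ?_)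
  · simp only [pastMid, mem_setOf_eq]
    constructor
    · rintro ⟨hw, h0, h1⟩; exact ⟨((h w h1).1).1 hw, h0, h1⟩
    · rintro ⟨hw, h0, h1⟩; exact ⟨((h w h1).1).2 hw, h0, h1⟩
  · simp only [pastMid, mem_setOf_eq]
    constructor
    · rintro ⟨hf, h0, h1⟩; exact ⟨((h f h1).2).1 hf, h0, h1⟩
    · rintro ⟨hf, h0, h1⟩; exact ⟨((h f h1).2).2 hf, h0, h1⟩

/-- `pastMid` is measurable. [folklore] -/
theorem measurable_pastMid (i y : ℤ) : Measurable (pastMid i y) :=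
  (measurable_set_iff.2 fun w => ((measurable_set_mem w).comp measurable_fst).and measurable_const).prodMk
    (measurable_set_iff.2 fun f => ((measurable_set_mem f).comp measurable_snd).and measurable_const)

/-- `rowBits` is measurable. [folklore] -/
theorem measurable_rowBits (i y : ℤ) : Measurable (rowBits i y) :=
  ((measurable_set_mem _).comp measurable_fst).prodMk
    (((measurable_set_mem _).comp measurable_snd).prodMk ((measurable_set_mem _).comp measurable_snd))

/-- `setMid` is jointly measurable in (configuration, bits). [folklore] -/
theorem measurable_setMid (i y : ℤ) : Measurable fun q : Obs × (Prop × Prop × Prop) => setMid i y q.1 q.2 := by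
  have hP : ∀ {f : Obs × (Prop × Prop × Prop) → Prop}, Measurable f → Measurable f := fun h => h
  refine (measurable_set_iff.2 fun w => ?_).prodMk (measurable_set_iff.2 fun f => ?_)
  · simp only [mem_setOf_eq]
    exact (measurable_const.and (measurable_fst.comp measurable_snd)).or
      (measurable_const.and ((measurable_set_mem w).comp (measurable_fst.comp measurable_fst)))
  · simp only [mem_setOf_eq]
    exact (measurable_const.and (measurable_fst.comp (measurable_snd.comp measurable_snd))).or
      ((measurable_const.and (measurable_snd.comp (measurable_snd.comp measurable_snd))).or
        (measurable_const.and (measurable_const.and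
          ((measurable_set_mem f).comp (measurable_snd.comp measurable_fst)))))

end Summit.CriticalPhenomena.CardyFormulaZ2.Theorems.IKLinearTransport.PinnedDiagramExchange
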